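import Summits.AtomisticToContinuum.FouriersLaw.Theses.OddSectorIrreversibility

/-!
# Stub `stub_upperIncrement` (U), helper II — quasi-subadditivity ALONE does not give (U)
# (sequence level), even granted Fourier's conclusion

Crux `stmt-AtomisticToContinuum-9141` (`OddSectorIrreversibility.BoundedResponseConverges`), line
`two-scale-gluing-log-rigidity`, registered stub `stub_upperIncrement` (U): eventually
`R_{N+1} ≤ R_N + C` for the bath-to-bath resistance `R_N := (N-1)/D_N`.

Helper I (`…StubUpperIncrementAux1.lean`, `upperIncrement_of_quasiSubadditive_of_superadditive`)
derives (U) from the TWO junction-locality cruxes `FeketeSeriesLaw.QuasiSubadditiveResistance`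
(stmt-14041: `R_{N+M} ≤ R_N + R_M + C`, `N, M ≥ 2`) AND `JunctionLocality.SuperadditiveResistance`
(stmt-11748: `R_N + R_M - C' ≤ R_{N+M}`). The theorem below shows that the first ALONE cannot do it by
any argument at the level of the response sequence, not even together with the crux's hypotheses
(`D 0 = D 1 = 0`, floor and ceiling `1/4 ≤ D_N ≤ 1` for `N ≥ 2`, `|D|` bounded) AND the crux's /
Fourier's conclusion `D_N → 1 > 0`: there is such a `D` whose resistance is EXACTLY subadditive on
`{N ≥ 2}` (the conclusion of stmt-14041 with `C = 0`) while `R_{4^j+1} - R_{4^j} ≥ 2^j` — so (U) fails.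

Witness: block slopes `σ_N = 1 + 2^{-⌊log₄ N⌋} ↓ 1`, `R_N = σ_N·N` except at the block entrances
`N = 4^j + 1` (`j ≥ 1`), where `R_N = (1 + 2^{-(j-1)})·N` keeps the PREVIOUS block's slope for one
more step (an isolated upward spike of height `2^j + 1 + 2^{1-j}` right after the slope drop at `4^j`).
Subadditivity survives because a spike at `n = a + b` (`a, b ≥ 2`) only sees `a, b < 4^j`, whose slopes
are at least the spike's slope; everywhere else `R = σ·id` with `σ` antitone. So, at sequence level,
(U) genuinely waits on BOTH stmt-14041 and stmt-11748 (or on `ParabolicBathMap.BathOrbitParabolic`,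
stmt-11919, alone — helper I). Pure real analysis; nothing here closes an item.
-/

noncomputable section

namespace Summit.AtomisticToContinuum.FouriersLaw.Cruxes.BoundedResponseConverges.TwoScaleGluingLogRigidity.Stubs

open Filter Topology

/-- **Quasi-subadditivity + Fourier's conclusion do not imply (U)** (sequence level): there is a
response-shaped `D : ℕ → ℝ` (`D 0 = D 1 = 0`, `1/4 ≤ D_N ≤ 1` for `N ≥ 2`, `|D|` bounded) with
`D_N → 1` whose resistance `R_N = (N-1)/D_N` is exactly subadditive on `{N ≥ 2}` — the conclusion of
`FeketeSeriesLaw.QuasiSubadditiveResistance` (stmt-14041) with constant `C = 0`, in that item's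
spelling — and yet the one-site increments `R_{N+1} - R_N` are unbounded above, i.e. the conclusion of
the registered stub `stub_upperIncrement` (spelled verbatim) FAILS. Witness: `R_N = (1 + 2^{-⌊log₄ N⌋})N`
off the block entrances `N = 4^j + 1` (`j ≥ 1`), where `R_N = (1 + 2^{1-j})N`. [folklore] -/
theorem quasiSubadditive_fourierShape_not_upperIncrement :
    ∃ D : ℕ → ℝ, D 0 = 0 ∧ D 1 = 0 ∧ (∀ N : ℕ, 2 ≤ N → 1 / 4 ≤ D N ∧ D N ≤ 1) ∧
      BddAbove (Set.range fun N => |D N|) ∧ Filter.Tendsto D Filter.atTop (nhds 1) ∧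
      (∀ N M : ℕ, 2 ≤ N → 2 ≤ M →
        ((N + M - 1 : ℕ) : ℝ) / D (N + M) ≤ ((N - 1 : ℕ) : ℝ) / D N + ((M - 1 : ℕ) : ℝ) / D M) ∧
      ¬ ∃ C : ℝ, ∃ N₀ : ℕ, ∀ N : ℕ, N₀ ≤ N →
          (((N + 1 : ℕ) : ℝ) - 1) / D (N + 1) ≤ ((N : ℝ) - 1) / D N + C := by
  -- block slope `σ N = 1 + (1/2)^⌊log₄ N⌋`
  set σ : ℕ → ℝ := fun N => 1 + (1 / 2 : ℝ) ^ Nat.log 4 N with hσ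
  -- the resistance: `σ N * N`, except at the block entrances `N = 4^j + 1`, `j ≥ 1`
  set R : ℕ → ℝ := fun N =>
    if 1 ≤ Nat.log 4 N ∧ N = 4 ^ Nat.log 4 N + 1 then (1 + (1 / 2 : ℝ) ^ (Nat.log 4 N - 1)) * N
    else σ N * N with hR
  -- elementary facts on `σ`
  have hhalf0 : (0 : ℝ) ≤ 1 / 2 := by norm_num
  have hhalf1 : (1 / 2 : ℝ) ≤ 1 := by norm_num
  have hεle : ∀ N, (1 / 2 : ℝ) ^ Nat.log 4 N ≤ 1 := fun N => pow_le_one₀ hhalf0 hhalf1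
  have hεnn : ∀ N, (0 : ℝ) ≤ (1 / 2 : ℝ) ^ Nat.log 4 N := fun N => pow_nonneg hhalf0 _
  have σ_anti : ∀ a b : ℕ, a ≤ b → σ b ≤ σ a := fun a b hab => by
    simp only [hσ]
    have := pow_le_pow_of_le_one hhalf0 hhalf1 (Nat.log_mono_right (b := 4) hab)
    linarith
  have σ_ge_one : ∀ N, 1 ≤ σ N := fun N => by
    simp only [hσ]; linarith [hεnn N]
  -- `(1/2)^(j-1) = 2 (1/2)^j` for `j ≥ 1`
  have hspike_pow : ∀ j : ℕ, 1 ≤ j → (1 / 2 : ℝ) ^ (j - 1) = 2 * (1 / 2) ^ j := fun j hj => by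
    obtain ⟨k, rfl⟩ : ∃ k, j = k + 1 := ⟨j - 1, by omega⟩
    rw [Nat.add_sub_cancel, pow_succ]; ring
  -- `σ N * N ≤ R N ≤ 2 N`, and `R N ≤ (1 + 2 (1/2)^log) N`
  have R_ge : ∀ N, σ N * N ≤ R N := fun N => by
    simp only [hR]
    split_ifs with h
    · have hp := hspike_pow _ h.1
      have h0 := hεnn N
      have hN0 : (0 : ℝ) ≤ N := by positivity
      simp only [hσ]
      rw [hp]
      nlinarith
    · exact le_rfl
  have R_le : ∀ N, R N ≤ (1 + 2 * (1 / 2 : ℝ) ^ Nat.log 4 N) * N := fun N => by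
    have hN0 : (0 : ℝ) ≤ N := by positivity
    simp only [hR]
    split_ifs with h
    · rw [hspike_pow _ h.1]
    · refine mul_le_mul_of_nonneg_right ?_ hN0
      simp only [hσ]; linarith [hεnn N]
  have R_le2 : ∀ N, R N ≤ 2 * N := fun N => by
    have hN0 : (0 : ℝ) ≤ N := by positivity
    simp only [hR]
    split_ifs with h
    · refine mul_le_mul_of_nonneg_right ?_ hN0
      have : (1 / 2 : ℝ) ^ (Nat.log 4 N - 1) ≤ 1 := pow_le_one₀ hhalf0 hhalf1
      linarith
    · refine mul_le_mul_of_nonneg_right ?_ hN0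
      simp only [hσ]; linarith [hεle N]
  have R_geN : ∀ N : ℕ, (N : ℝ) ≤ R N := fun N => by
    have hN0 : (0 : ℝ) ≤ N := by positivity
    have := mul_le_mul_of_nonneg_right (σ_ge_one N) hN0
    rw [one_mul] at this
    exact this.trans (R_ge N)
  have R_pos : ∀ N, 1 ≤ N → 0 < R N := fun N hN => by
    have : (1 : ℝ) ≤ N := by exact_mod_cast hN
    linarith [R_geN N]
  -- SUBADDITIVITY of `R` on `{N ≥ 2}`
  have R_sub : ∀ a b : ℕ, 2 ≤ a → 2 ≤ b → R (a + b) ≤ R a + R b := by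
    intro a b ha hb
    have ha0 : (0 : ℝ) ≤ a := by positivity
    have hb0 : (0 : ℝ) ≤ b := by positivity
    by_cases hsp : 1 ≤ Nat.log 4 (a + b) ∧ a + b = 4 ^ Nat.log 4 (a + b) + 1
    · -- spike at `n = a + b = 4^j + 1`: both `a, b < 4^j`, so their slopes are ≥ the spike slope
      set j := Nat.log 4 (a + b) with hj
      have hval : R (a + b) = (1 + (1 / 2 : ℝ) ^ (j - 1)) * ((a + b : ℕ) : ℝ) := by
        simp only [hR]; rw [if_pos hsp]
      have hlt_a : a < 4 ^ j := by have := hsp.2; omega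
      have hlt_b : b < 4 ^ j := by have := hsp.2; omega
      have hloga : Nat.log 4 a ≤ j - 1 := by
        have := Nat.log_lt_of_lt_pow (by omega) hlt_a; omega
      have hlogb : Nat.log 4 b ≤ j - 1 := by
        have := Nat.log_lt_of_lt_pow (by omega) hlt_b; omega
      have hσa : 1 + (1 / 2 : ℝ) ^ (j - 1) ≤ σ a := by
        simp only [hσ]; linarith [pow_le_pow_of_le_one hhalf0 hhalf1 hloga]
      have hσb : 1 + (1 / 2 : ℝ) ^ (j - 1) ≤ σ b := by
        simp only [hσ]; linarith [pow_le_pow_of_le_one hhalf0 hhalf1 hlogb]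
      calc R (a + b) = (1 + (1 / 2 : ℝ) ^ (j - 1)) * a + (1 + (1 / 2 : ℝ) ^ (j - 1)) * b := by
              rw [hval]; push_cast; ring
        _ ≤ σ a * a + σ b * b :=
              add_le_add (mul_le_mul_of_nonneg_right hσa ha0) (mul_le_mul_of_nonneg_right hσb hb0)
        _ ≤ R a + R b := add_le_add (R_ge a) (R_ge b)
    · -- regular point: `R (a+b) = σ (a+b) (a+b)` with `σ` antitone
      have hval : R (a + b) = σ (a + b) * ((a + b : ℕ) : ℝ) := by
        simp only [hR]; rw [if_neg hsp]
      have hσa : σ (a + b) ≤ σ a := σ_anti a (a + b) (by omega)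
      have hσb : σ (a + b) ≤ σ b := σ_anti b (a + b) (by omega)
      calc R (a + b) = σ (a + b) * a + σ (a + b) * b := by rw [hval]; push_cast; ring
        _ ≤ σ a * a + σ b * b :=
              add_le_add (mul_le_mul_of_nonneg_right hσa ha0) (mul_le_mul_of_nonneg_right hσb hb0)
        _ ≤ R a + R b := add_le_add (R_ge a) (R_ge b)
  -- the SPIKE: `R (4^(k+1) + 1) - R (4^(k+1)) ≥ 2^(k+1)`
  have R_spike : ∀ k : ℕ, R (4 ^ (k + 1)) + 2 ^ (k + 1) < R (4 ^ (k + 1) + 1) := by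
    intro k
    have hlog1 : Nat.log 4 (4 ^ (k + 1)) = k + 1 := Nat.log_pow (by norm_num) _
    have hlog2 : Nat.log 4 (4 ^ (k + 1) + 1) = k + 1 := by
      apply Nat.log_eq_of_pow_le_of_lt_pow (by omega)
      rw [pow_succ 4 (k + 1)]
      have : 1 ≤ 4 ^ (k + 1) := Nat.one_le_pow _ _ (by norm_num)
      omega
    have hR1 : R (4 ^ (k + 1)) = (1 + (1 / 2 : ℝ) ^ (k + 1)) * ((4 ^ (k + 1) : ℕ) : ℝ) := by
      simp only [hR, hσ]; rw [hlog1, if_neg]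
      exact fun h => absurd h.2 (Nat.succ_ne_self _).symm
    have hR2 : R (4 ^ (k + 1) + 1) = (1 + (1 / 2 : ℝ) ^ k) * ((4 ^ (k + 1) + 1 : ℕ) : ℝ) := by
      simp only [hR]; rw [hlog2, if_pos ⟨by omega, rfl⟩, Nat.add_sub_cancel]
    have hx : (1 / 2 : ℝ) ^ k = 2 * (1 / 2) ^ (k + 1) := by rw [pow_succ]; ring
    have hP : ((4 : ℝ) ^ (k + 1)) * (1 / 2) ^ (k + 1) = 2 ^ (k + 1) := by
      rw [← mul_pow]; norm_num
    have hxnn : (0 : ℝ) ≤ (1 / 2) ^ (k + 1) := pow_nonneg hhalf0 _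
    rw [hR1, hR2, hx]
    push_cast
    nlinarith [hP, hxnn]
  -- the WITNESS
  set D : ℕ → ℝ := fun N => if N < 2 then 0 else ((N : ℝ) - 1) / R N with hD
  have hval : ∀ N : ℕ, 2 ≤ N → D N = ((N : ℝ) - 1) / R N := fun N hN => by
    have h : ¬ N < 2 := by omega
    simp only [hD, h, if_false]
  have hN1 : ∀ N : ℕ, 2 ≤ N → (0 : ℝ) < (N : ℝ) - 1 := fun N hN => by
    have : (2 : ℝ) ≤ N := by exact_mod_cast hN
    linarith
  have hDpos : ∀ N : ℕ, 2 ≤ N → 0 < D N := fun N hN => by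
    rw [hval N hN]; exact div_pos (hN1 N hN) (R_pos N (by omega))
  -- the resistance of `D` IS `R`
  have hres : ∀ N : ℕ, 2 ≤ N → ((N : ℝ) - 1) / D N = R N := fun N hN => by
    rw [hval N hN]
    have h1 := (hN1 N hN).ne'
    have h2 := (R_pos N (by omega)).ne'
    field_simp
  -- floor and ceiling
  have hbounds : ∀ N : ℕ, 2 ≤ N → 1 / 4 ≤ D N ∧ D N ≤ 1 := fun N hN => by
    rw [hval N hN]
    have hn1 := hN1 N hN
    have hRp := R_pos N (by omega)
    have hN2 : (2 : ℝ) ≤ N := by exact_mod_cast hN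
    constructor
    · -- `R N ≤ 2N ≤ 4 (N - 1)`
      rw [div_le_div_iff₀ (by norm_num) hRp]
      nlinarith [R_le2 N]
    · rw [div_le_one hRp]; linarith [R_geN N]
  refine ⟨D, by simp [hD], by simp [hD], hbounds, ⟨1, ?_⟩, ?_, ?_, ?_⟩
  · -- `|D| ≤ 1`
    rintro _ ⟨N, rfl⟩
    dsimp only
    by_cases hN : 2 ≤ N
    · obtain ⟨hl, hu⟩ := hbounds N hN
      rw [abs_of_nonneg (by linarith)]; exact hu
    · have hlt : N < 2 := by omega
      have h0 : D N = 0 := by simp only [hD]; exact if_pos hlt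
      rw [h0]; norm_num
  · -- `D N → 1`: squeeze between `(N-1)/N / (1 + 2 (1/2)^⌊log₄ N⌋)` and `(N-1)/N`
    have hεlim : Tendsto (fun N : ℕ => (1 / 2 : ℝ) ^ Nat.log 4 N) atTop (𝓝 0) := by
      have hlog : Tendsto (fun N : ℕ => Nat.log 4 N) atTop atTop :=
        tendsto_atTop_atTop.2 fun b => ⟨4 ^ b, fun n hn => Nat.le_log_of_pow_le (by norm_num) hn⟩
      exact (tendsto_pow_atTop_nhds_zero_of_lt_one hhalf0 (by norm_num)).comp hlog
    have hfrac : Tendsto (fun N : ℕ => ((N : ℝ) - 1) / N) atTop (𝓝 1) := by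
      have h1 : Tendsto (fun N : ℕ => 1 - ((N : ℝ))⁻¹) atTop (𝓝 (1 - 0)) :=
        tendsto_const_nhds.sub tendsto_inv_atTop_nhds_zero_nat
      rw [sub_zero] at h1
      refine h1.congr' ?_
      filter_upwards [eventually_ge_atTop 1] with N hN
      have hN' : (N : ℝ) ≠ 0 := by
        have : (1 : ℝ) ≤ N := by exact_mod_cast hN
        linarith
      field_simp
    have hden : Tendsto (fun N : ℕ => 1 + 2 * (1 / 2 : ℝ) ^ Nat.log 4 N) atTop (𝓝 1) := by
      have := (hεlim.const_mul 2).const_add 1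
      simpa using this
    have hlow : Tendsto (fun N : ℕ => ((N : ℝ) - 1) / N / (1 + 2 * (1 / 2 : ℝ) ^ Nat.log 4 N))
        atTop (𝓝 1) := by
      have h := hfrac.div hden one_ne_zero
      rw [div_one] at h
      exact h
    refine tendsto_of_tendsto_of_tendsto_of_le_of_le' hlow hfrac ?_ ?_
    · filter_upwards [eventually_ge_atTop 2] with N hN
      rw [hval N hN, div_div]
      have hNpos : (0 : ℝ) < N := by
        have : (2 : ℝ) ≤ N := by exact_mod_cast hN
        linarith
      have hd : (0 : ℝ) < (N : ℝ) * (1 + 2 * (1 / 2 : ℝ) ^ Nat.log 4 N) := by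
        have := hεnn N; positivity
      refine div_le_div_of_nonneg_left (hN1 N hN).le (R_pos N (by omega)) ?_
      have := R_le N
      linarith
    · filter_upwards [eventually_ge_atTop 2] with N hN
      rw [hval N hN]
      have hNpos : (0 : ℝ) < N := by
        have : (2 : ℝ) ≤ N := by exact_mod_cast hN
        linarith
      exact div_le_div_of_nonneg_left (hN1 N hN).le hNpos (R_geN N)
  · -- exact subadditivity of the resistance, in stmt-14041's spelling
    intro N M hN hM
    have e1 : ((N + M - 1 : ℕ) : ℝ) = (((N + M : ℕ) : ℝ) - 1) := by
      rw [Nat.cast_sub (by omega), Nat.cast_one]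
    have e2 : ((N - 1 : ℕ) : ℝ) = (N : ℝ) - 1 := by
      rw [Nat.cast_sub (by omega), Nat.cast_one]
    have e3 : ((M - 1 : ℕ) : ℝ) = (M : ℝ) - 1 := by
      rw [Nat.cast_sub (by omega), Nat.cast_one]
    rw [e1, e2, e3, hres N hN, hres M hM, hres (N + M) (by omega)]
    exact R_sub N M hN hM
  · -- the one-site increments are unbounded: look at `N = 4^(k+1)`, `k ≥ N₀, ⌈C⌉₊`
    rintro ⟨C, N₀, hC⟩
    set k : ℕ := max N₀ ⌈C⌉₊ with hk
    have hkN : N₀ ≤ k := le_max_left _ _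
    have hkC : ⌈C⌉₊ ≤ k := le_max_right _ _
    have hpow : k + 1 < 4 ^ (k + 1) := Nat.lt_pow_self (by norm_num)
    have hN₀ : N₀ ≤ 4 ^ (k + 1) := by omega
    have h2 : 2 ≤ 4 ^ (k + 1) := by
      have : 4 ≤ 4 ^ (k + 1) := by
        calc 4 = 4 ^ 1 := by norm_num
          _ ≤ 4 ^ (k + 1) := Nat.pow_le_pow_right (by norm_num) (by omega)
      omega
    have h := hC (4 ^ (k + 1)) hN₀
    rw [hres (4 ^ (k + 1) + 1) (by omega), hres (4 ^ (k + 1)) h2] at h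
    have hs := R_spike k
    -- `C < 2^(k+1)`
    have hCk : C < (2 : ℝ) ^ (k + 1) := by
      have h1 : C ≤ (⌈C⌉₊ : ℝ) := Nat.le_ceil C
      have h2 : (⌈C⌉₊ : ℝ) ≤ k := by exact_mod_cast hkC
      have h3 : (k : ℝ) + 1 ≤ (2 : ℝ) ^ (k + 1) := by
        have : k + 1 < 2 ^ (k + 1) := Nat.lt_two_pow_self
        exact_mod_cast this.le
      linarith
    linarith

end Summit.AtomisticToContinuum.FouriersLaw.Cruxes.BoundedResponseConverges.TwoScaleGluingLogRigidity.Stubs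

end
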